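import Mathlib
import HarnessLib
import HarnessLib.Audit
import Summits.QuantumFields.Statement
import Summits.QuantumFields.QCD.Theorems.NestedDissectionSeaThresholdShift

/-!
Route: RenormalisedVafaWitten

DORMANT since 2026-09-03T11:25:34Z (reconciler: no traction for 5 d (last activity statement-checked at 2026-08-29T10:33:33Z); parked, not closed — `ledger route dormant route-QuantumFields-RenormalisedVafaWitten --off` to reactivate) — unstaffed, not closed; items shared with open routes are served there. `ledger route dormant <id> --off` reactivates.

# Route RenormalisedVafaWitten — renormalised paramagnetic bound — quark lines shield flavoured
channels at the RUNNING mass; what is left of the gap is the unquenched gauge marginal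

It suffices to show X = A ∧ G (card QuantumFields/QCD/renormalised-vafa-witten; shape re-typed
2026-08-16 after `QCDOf` gained the conjunct `reg.IsChiralAtZero`, p117723). A
(LineShieldedChiralContinuum, rank 2 — the card's UV-existence half, its item A1 and the new chiral
clause merged into ONE existential over the CONSTRUCTED regularisation): for N_f = 2, 3 there is a
mass-independent regularisation `reg` with `HasMassScaling`, CHIRAL AT ZERO (`reg.IsChiralAtZero`,
carried verbatim: for every ε > 0 some positive mass tuple has no uniform lattice gap ε — the
lattice gap closes as m → 0⁺ along the sequence, i.e. m_crit(k) IS the chiral point; nothing is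
claimed at fixed k), along which massive lattice QCD with dynamical quarks has a continuum limit for
every m > 0 (`IsQCDAlong`, non-trivial non-Gaussian glue, non-decoupled flavour-changing
pseudoscalars — no gap clause), AND along which the flavour-changing pseudoscalar two-point function
⟨P_fg(0) P_gf(n e₀)⟩_{k,S} decays, on every mass window (0, M̄], at the RENORMALISED rate c(M̄)·(m_f
+ m_g)·a_k per Euclidean time step, uniformly in k and in the torus 2S+1 ≥ 2L_k+1 — threshold ZERO:
with m_crit pinned to the chiral point the running mass of flavour f is ∝ m_f itself, the rate is a
factor Z_m(k) ≍ (log a_k⁻²)^{γ₀/2β₀} beyond any configuration-wise (Vafa–Witten/hopping) bound,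
which can only deliver the BARE rate a_k m/Z_m(k) (support MassRenormalisationDiverges), and it lies
below the Goldstone law m_π ≍ √(B(m_f+m_g)) ≥ √(B/2M̄)·(m_f+m_g) on every window, so the shield is
consistent with the chiral clause. G (GapFromLineShield, rank 3, unchanged): for every admissible
`reg`, every M₀ ≥ 0 and the line bound above M₀ ⇒ for every m > M₀ and every continuum limit T of
the scheme one Δ > 0 with `T.HasMassGap Δ ∧ HasLatticeMassGap Δ` — used at M₀ = 0; after the line
shield this is clustering of the unquenched gauge marginal on line-disconnected (hairpin /
Wilson-loop) functionals: the Yang–Mills-type core. WHY THE PRE-RE-TYPE SHAPE DIED: the old assembly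
took the threshold M₀ ≥ 0 of the ∀-form bound L (RenormalisedQuarkLineBound) and shifted m_crit ↦
m_crit + a_k M₀/Z_m (ThresholdShift); the shifted regularisation is chiral at zero only if the gap
of the unshifted one closes as m → M₀⁺, which no item supplies and which is false whenever M₀
exceeds the true chiral offset (re-type probe `shifted_not_chiral`) — the re-type removes exactly
this freedom, so the exhibited `reg` must be used unshifted and the shield must reach the chiral
point. WHY THE SHIELD MOVED INTO THE EXISTENTIAL: in ∀-form over admissible chiral regularisations a
threshold-0 bound is hostage to regularisations whose m_crit sits BELOW the chiral line (offset δ <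
0: `IsChiralAtZero` then holds through the would-be massless point m = |δ|·1, admissibility fails
there only if chiral symmetry breaking makes the torus limit non-clustering, and the bound fails at
that point), so its proof would have to decide χSB at a sub-critical offset — foreign to the
quark-line mechanism; for the CONSTRUCTED regularisation m_crit(k) is the flow's critical mass by
fiat and the bound is the renormalised paramagnetic estimate proper. L (threshold ∀-form) and E
(DynamicalQuarkContinuum, shared with IntegerCriticalLine) stay as supports: A ⇒ E, and L is the
attackable ∀-shadow of A's last clause.
Lean: `LineShieldedChiralContinuum ∧ GapFromLineShield`

## Assembly
Pure logic, machine-checked sorry-free in the planner's Sketch.lean (`closes`, lean rc 0, axioms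
propext / Classical.choice / Quot.sound): fix N_f ∈ {2,3}; LineShieldedChiralContinuum gives reg
with HasMassScaling, IsChiralAtZero, the existence data for every m > 0 (hence GapFromLineShield's
admissibility data) and the threshold-0 line bound, which is GapFromLineShield's window hypothesis
at M₀ = 0 (`simpa only [sub_zero]`); GapFromLineShield returns, for every m > 0 and the data's own
(z, shift, T), one Δ > 0 with T.HasMassGap Δ ∧ (reg.scheme m z shift).HasLatticeMassGap Δ; hence
QCDOf N_f = ⟨reg, HasMassScaling, IsChiralAtZero, body⟩ and QCD = QCDOf 2 ∧ QCDOf 3. ThresholdShift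
(proved, shared) no longer enters and is dropped from this route's items; the Assembly item reads
LineShieldedChiralContinuum → GapFromLineShield → QCD.

Rationale: WHY THIS LINE. Vafa–Witten's paramagnetic bound (VafaWitten1984NPB; Weingarten1983) — `i·(Hermitian)
+ m` has no spectrum within m of 0, so `|(D̸_U+m)⁻¹(x,y)| ≤ C e^{−cm|x−y|}` for EVERY gauge field —
is the one fermionic estimate that is configuration-wise, sign-blind and volume-uniform; but inside
any configuration-uniform bound the rate is a bare-cutoff quantity (it holds for U ≡ 1), and along a
scheme with `HasMassScaling` the bare mass in physical units is m/Z_m(k) → 0 like (log a_k⁻¹)^{−4/9}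
(MontvayMunster1994 (5.84), (5.91); support MassRenormalisationDiverges), while for Wilson quarks
accretivity is lost outright once m_crit(k) < 0. The line therefore asks for the bound in
RENORMALISED form — a statement about typical rough fields under the QCD measure, to be proved by
integrating out gauge and fermion fluctuations above a physical scale μ₁ with g(μ₁) ≪ 1 (block RG:
Balaban1987RG1, Balaban1988Convergent, BalabanOcarrollSchor1989, Dimock2022QED3) and applying
accretivity/Combes–Thomas (ChulaevskySuhov2014 Thm 2.3.3; supports AccretiveCombesThomas,
WilsonDiracAccretive) to the effective quark kernel on small fields, with `det D · D⁻¹ = adj D`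
across large fields. Imported areas: numerical-range/Combes–Thomas resolvent estimates (random
Schrödinger operators) and constructive multiscale RG; no probabilistic reformulation of the gap
itself. What it does that no prior route does: it cuts `HasLatticeMassGap` by DIAGRAM TOPOLOGY —
every cross-contracted quark line decays by the shield, so the Millennium-grade remainder G is a
clustering statement about ONE signed, quasi-locally perturbed pure-gauge measure with NO valence
lines, the input format every robust-Yang–Mills bridge wants; and since the 2026-08-16 re-type pins
the additive offset of m_crit to the chiral point (`IsChiralAtZero`), it states the flavoured shield
down to m → 0⁺ with a rate linear in the RENORMALISED masses — below the Goldstone law m_π² ≍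
B(m_f+m_g) (GellmannOakesRenner1968; MontvayMunster1994 §5.3, PCAC (5.140) and (5.207)) on every
window (0, M̄], hence consistent with chiral dynamics, with the superheavy regime (M_meson/M_RGI ∼
α_s(m)^{4/9} → 0) fenced by M̄.

RANKED CRUXES. #2 LineShieldedChiralContinuum (crux) — (card A1 + the shared UV-existence half + the
re-typed chiral clause, ONE existential over the constructed regularisation) for N_f = 2 and N_f = 3
there is `reg : QCDRegularisation N_f` with (i) `HasMassScaling`; (ii) `reg.IsChiralAtZero` (∀ ε > 0
some positive tuple has no uniform lattice gap ε: the gap closes as m → 0⁺ along the sequence);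
(iii) for every m > 0 some z, shift, T with `IsQCDAlong (reg.scheme m z shift) T`, `T.IsNontrivial
glue`, `T.IsNonGaussian glue`, `T.IsNontrivial (pseudoRe f g)` for all f ≠ g; (iv) for every M̄
there is c > 0 with: for all m ∈ (0, M̄]^{N_f}, all f ≠ g, some C, eventually in k, on every torus
2S+1 ≥ 2L_k+1 and all n ≤ S, ‖⟨P_fg(0) P_gf(n e₀)⟩_{k,S}‖ ≤ C exp(−c(m_f+m_g) a_k n)
(`qcdTorusExpect` of the product of the tree's `pseudoscalarBilinear`s at β_k and bare masses
m_crit(k) + a_k m/Z_m(k); ⟨P_fg⟩ = 0 by flavour symmetry, so this IS the connected function). Most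
informative item: (iv) is the route's bet and (ii) the new obligation; if (iv) is unreachable the
quantum-number cut is illusory. [difficulty: open-problem] (why it might fail: stacks three open
problems on ONE reg — 4D UV existence with dynamical Wilson quarks (m_crit tuned in the flow,
renormalon-ambiguous); chiral softness (ii) is a Goldstone UPPER law foreign to paramagnetic LOWER
bounds; (iv)'s k,S-uniform C fights ⟨sign⟩⁻¹ for N_f = 3 / split N_f = 2; accretivity is not
RG-covariant; the (−1)^F-twisted torus functional needs vacuum dominance.) [VafaWitten1984NPB,
Weingarten1983, BalabanOcarrollSchor1989, Balaban1988Convergent, Dimock2022QED3, MontvayMunster1994,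
GellmannOakesRenner1968, SharpeSingleton1998, EdwardsHellerNarayanan1998, MohlerSchaefer2020]
#3 GapFromLineShield (crux, unchanged, used at M₀ = 0) — (card A2 + the transfer to the continuum
gap) for N_f ∈ {2,3}, every `reg` with `HasMassScaling` and admissibility data, every M₀ ≥ 0 for
which the window line bound holds above M₀: for all m with every m_f > M₀ and every z, shift, T with
`IsQCDAlong (reg.scheme m z shift) T` there is Δ > 0 with `T.HasMassGap Δ ∧ (reg.scheme m z
shift).HasLatticeMassGap Δ`. With the cross-contracted diagrams shielded, what remains is clustering
of the unquenched (signed) gauge marginal on the line-disconnected functionals Wick(A), Wick(B) —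
the perturbed pure-gauge core — plus the transfer-matrix bookkeeping from operator-norm-uniform
lattice decay to `T.HasMassGap`. [deps: LineShieldedChiralContinuum] [difficulty: open-problem] (why
it might fail: Millennium-grade: the neutral sector still needs k-uniform clustering of the
unquenched gauge marginal on hairpin and Wilson-loop functionals — pure Yang–Mills difficulty plus a
signed non-local weight for N_f = 3; nothing bridges Balaban's small-field UV regime to confinement
scales.) [JaffeWitten2000, Luscher1977, OsterwalderSeiler1978, Balaban1989LargeFieldII, Seiler1982,
MagnenRivasseauSeneor1993]
#9 RenormalisedQuarkLineBound (support; was crux #2 until the re-type) — the THRESHOLD ∀-form of the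
shield: along every admissible `reg` with `HasMassScaling` there is M₀ ≥ 0 such that (iv) holds on
windows (M₀, M̄] with rate c((m_f−M₀)+(m_g−M₀)). Robust (the threshold absorbs any offset of
m_crit), still stamped, but off the deciding path: a threshold bound along an arbitrary admissible
reg can no longer be shifted into `QCDOf`. Kept as the attackable ∀-shadow of (iv) — a STRUCTURAL
refutation of it (e.g. the sign objection made quantitative) kills (iv) too. [difficulty:
open-problem]
#9 DynamicalQuarkContinuum (support here; crux of IntegerCriticalLine) — (iii) with (i) alone, the
old `QCDOf` minus its gap clauses; implied by #2, shared, kept for the link. [difficulty: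
open-problem]
#9 AccretiveCombesThomas (support) — (card F1/A4, abstract form; provable now, candidate proof
attached 2026-08-16) on a finite index set with a symmetric integer quasi-metric `dist`, a matrix D
of range ≤ 1 that is m-accretive (m Σ‖v_i‖² ≤ Re⟨v, Dv⟩, m > 0) with off-diagonal row and column
ℓ¹-sums ≤ h is invertible and, for every θ ≥ 0 with h(e^θ − 1) ≤ m/2, obeys ‖D⁻¹ i j‖ ≤ (2/m)
e^{−θ·dist i j}. Twin of the tree's `HoppingExpansionUniformGap_holds` with accretivity replacing
|κ|h < 1; it is the configuration-wise shield whose rate F2 shows to be bare. [difficulty: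
provable-now] [ChulaevskySuhov2014, VafaWitten1984NPB]
#9 WilsonDiracAccretive (support) — (card F1 for Wilson; provable now) for a unitary representation
ρ, any gauge field U on any torus, r ≥ 0 and any real m, the tree's `wilsonDirac ρ U m r` satisfies
m Σ‖v_i‖² ≤ Re⟨v, D_W v⟩. With AccretiveCombesThomas this is the pathwise Vafa–Witten shield at each
k where the bare mass is positive — and it is EMPTY along the honest Wilson trajectory once
m_crit(k) < 0, which is why the shield is renormalised. [difficulty: provable-now]
[MontvayMunster1994, VafaWitten1984NPB, Wilson1975]
#9 MassRenormalisationDiverges (support; candidate proof attached) — for N_f ≤ 16 and every `reg`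
with `HasMassScaling`, Z_m(k) → ∞; hence no configuration-uniform rate can be k-uniform in physical
units — the design rule refuters may cite against pathwise-rate claims. [difficulty: provable-now]
[MontvayMunster1994]
(dropped from this route at the repair: ThresholdShift — PROVED, `thresholdShift_proof`, still
wanted by HeavyThresholdYMBridge / IntegerCriticalLine / NestedDissectionSea — the audit-g7 shift
reg ↦ reg' with m_crit' = m_crit + a_k M₀/Z_m; the re-type forbids using it towards `QCDOf` (probe
`shifted_not_chiral`), so it no longer belongs to this route's item list, and dropping it also
removes the route file's only cross-route import.)

TWO-LAYER PLAN. Foreseen, NOT filed now (k ≤ 3, depth 1). LineShieldedChiralContinuum ⇐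
PinnedChiralContinuum (∃ reg with (i)–(iii) AND an intrinsic PIN certificate P(reg) identifying
m_crit(k) with the flow's critical mass to o(a_k/Z_m(k)) — candidate P: the flavoured axial
Ward-identity (PCAC) mass along the trajectory is κ·m_f·(1+o(1)), MontvayMunster1994 §5.3.2
(5.171)–(5.181); typable over the tree's `QCDCurrentSector` (local axial current and pseudoscalar
density as `QCDLatticeObservable`s, landed for AnomalyRigidity) as an asymptotic ratio of torus
correlators — not filed at this repair) → PinnedLineShield (∀ reg: HasMassScaling → admissibility →
P(reg) → (iv); inside it the old chain BlockedKernelAccretive (after j(k) ≈ log_M(1/(a_k μ₁))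
Bałaban–BOS block steps the small-field effective quark kernel is c·Z(k)(m₀ − m_c(k))-accretive in
the block inner product, with m_c(k) produced by the flow and matched to P) →
SmallLargeFieldCombesThomas (AccretiveCombesThomas on small fields, adj(D) across sparse large
fields, vacuum dominance of the twisted torus functional, the signed normalisation carried as a
convergent reweighting)) → LineShieldedChiralContinuum; not filed because P is not typable yet and
PinnedLineShield WITHOUT P is hostage to sub-critical offsets (thesis). GapFromLineShield ⇐
QuarkLineSplit (exact: ⟨AB⟩ − ⟨A⟩⟨B⟩ = E[cross-contracted(A,B)] + Cov(Wick A, Wick B) under the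
unquenched signed marginal; needs the definition request below) → GaugeMarginalClustering (k-uniform
clustering of the unquenched marginal on bounded quasi-local gauge functionals: the YM-type core,
candidate import from a robust `YangMills`) → GapFromLineShield (at M₀ = 0, with the cross term
handled by the general-observable form of (iv) and the transfer-matrix passage to T.HasMassGap).

KILL CRITERIA. A is an existential: it is refuted only with `QCDOf`-minus-gap itself or by a
STRUCTURAL argument against clause (iv) or (ii) — (a) a refuter evidence file showing that along ANY
admissible chiral regularisation the flavour-changing pseudoscalar channel must carry, on some
window (0, M̄], a state lighter than c·(m_f+m_g) for every c > 0 (contradicts GMOR m_π² ≍ B(m_f+m_g)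
≥ c²(m_f+m_g)² for m ≤ M̄ and heavy-quark scaling — it would signal a mis-typed clause: restate);
(b) the sign objection made quantitative — ⟨sign⟩_{k,S} → 0 for N_f = 3 (or split N_f = 2) along
EVERY asymptotically scaling sequence so fast that no expansion can carry it as a convergent
reweighting (kills the proof idea for N_f = 3; record, make N_f = 2 degenerate the first target, and
close `exhausted` if even that has no k,S-uniform C); (c) the one-loop accretivity test of CHEAPEST
FALSIFIER failing kills the accretive proof idea (pivot the foreseen split to a
numerical-range-of-Schur-complement quantity; close `exhausted` if none exists).
RenormalisedQuarkLineBound refuted by a reg-specific pathology does not kill A (drop L with a note);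
refuted structurally it does. If GapFromLineShield is shown to need nothing from the shield (a
half-spectrum argument made k-uniform on tori), re-rank G to 2 and keep (iv) as the mass-uniform
strengthening. DynamicalQuarkContinuum refuted closes every QCD route. Mooted if another route lands
`QCDOf` first.

NOT DECOMPOSED YET. The block-RG vocabulary for fermions coupled to a dynamical non-abelian gauge
field (needed even to TYPE BlockedKernelAccretive); the PIN certificate P of the two-layer plan (the
PCAC mass over `QCDCurrentSector`, D3); the chiral-softness clause (ii) of A — a Goldstone UPPER law
(m_π → 0 as m → 0⁺) foreign to paramagnetic LOWER bounds, to be imported once a sibling lands it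
(ChiralSpinWaves.ChiralWindow's upper law, AnomalyRigidity's anomaly route to no-uniform-gap,
EulerDescent.ChiralCornerSoftness; Vafa–Witten's own eigenvalue inequality VafaWitten1984CMP yields
gaplessness only for ≥ 4 massless flavours, so it does not serve N_f = 2, 3); the general-observable
form of (iv) (all cross-contracted quark-line diagrams between two `QCDLatticeObservable`s, baryons
included — needs the flavour grading and the Wick/quark-line decomposition API requested below); the
free-pole-mass saturation lemma (free Wilson r = 1 propagator at bare mass μ decays no faster than
log(1+μ) per step — the quantitative half of F2); constants c(M̄) and the superheavy window; the
passage lattice decay ⇒ `T.HasMassGap` via Lüscher's transfer matrix (inside G). All layer-2, after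
a crux moves.

CHEAPEST FALSIFIER. One-loop lattice perturbation theory, pencil or kit, one afternoon: integrate
gauge momenta in [μ₁, π/a] against the Wilson (r = 1) quark kernel on a CONSTANT abelian background
and read off whether the induced local terms shift the Hermitian (Wilson + mass) part UP by the
Z_m-running of (m₀ − m_c) while leaving the γ-part anti-Hermitian to O(g²) — the sign-and-structure
test of the accretive proof idea behind (iv) (card's fastest refutation (iii)). For the re-typed
clause, already settled on paper: the threshold-0 rate c(M̄)(m_f+m_g) lies BELOW the Goldstone and
heavy-quark masses on every window (√(B(m_f+m_g)) ≥ √(B/2M̄)·(m_f+m_g) for m_f, m_g ≤ M̄) — a window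
where it did not would falsify (iv) outright. Cheaper still: the free check that pathwise bounds are
saturated by U ≡ 1 at pole mass log(1 + a m/Z_m) and that `massExponent 3 = 4/9` (tree) makes that
rate o(1) in physical units — which is why no configuration-wise item is ranked.

NUMBERS. γ₀/(2β₀) = 12/(33 − 2N_f): 4/9 (N_f = 3, tree `massExponent_three`), 12/29 (N_f = 2);
Z_m(k)⁻¹ at a = 0.1 / 0.05 / 0.01 fm with Λ = 340 MeV: (log a⁻²Λ⁻²)^{−4/9} ≈ 0.46 / 0.41 / 0.34
(slow but → 0). GMOR scale B = m_π²/(m_u+m_d) ≈ (138 MeV)²/(6.8 MeV) ≈ 2.8 GeV (MS-bar 2 GeV), so on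
the window M̄ = 1 GeV the shield constant must satisfy c(M̄) ≲ √(B/2M̄) ≈ 1.2 near the chiral corner
— no tension. Hopping-domain constant h = 16√3 (r = 1, SU(3), d = 4) from the tree barrier;
accretivity constant of `wilsonDirac ρ U m r`: exactly m (support). Superheavy caveat: M_{QQ̄}/M_RGI
∼ 2(α_s(m)/π)^{4/9} → 0, hence the window M̄. Items after the repair: 8 (2 cruxes, 5 supports of
which 2 candidate-proved, 1 assembly).

DEFINITION REQUESTS. (D1) `fermiFlavourAct` / flavour-charge grading of `BoxFermiAlg N_f R` by
U(1)^{N_f} (copy of `fermiGaugeAct` with a site-independent diagonal flavour phase) and the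
predicate "observable of flavour charge q" on `QCDLatticeObservable` — to state the
general-observable form of (iv). (D2) `quarkLineDecomposition`: the Wick/Berezin expansion of
`qcdTorusExpect (A.onTorus * B.onTorus)` into cross-contracted and line-disconnected parts over
`quarkPropagator`-type entries and minors of `diracMatrix` (adjugate form, valid on exceptional
configurations) — to state QuarkLineSplit and GaugeMarginalClustering. (D3) the PCAC (axial
Ward-identity) quark mass of Wilson fermions along a scheme, as an asymptotic ratio ⟨∇₀A₀^{fg}(n e₀)
P^{gf}(0)⟩ / 2⟨P^{fg}(n e₀) P^{gf}(0)⟩ built from the tree's `QCDCurrentSector` bilinears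
(MontvayMunster1994 §5.3.2 (5.171)–(5.181)) — to type the PIN certificate P; the currents themselves
already exist. All under Literature/MathematicalPhysics/QuantumFieldTheory next to `QCDOS`. Cite
fact wanted: Lüscher's positive transfer matrix for Wilson fermions, r = 1, |κ| < 1/6 (Luscher1977;
MontvayMunster1994 (4.111)).

Novelty: Searches (2026-08-15): `lit search --hybrid "Vafa Witten paramagnetic bound fermion propagator
exponential decay quark mass gauge field"` (12 held textbooks: Bietenholz–Wiese 2025 pp. 242/425,
Montvay–Münster, Donoghue et al. — textbook VW, no renormalised rate); `lit search --hybrid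
"Combes-Thomas estimate exponential decay of the resolvent kernel"` (ChulaevskySuhov2014 §2.3.3 Thm
2.3.3, Hislop–Sigal 1996 — self-adjoint form); `lit search --source crossref "Vafa Witten theorem
quark mass meson mass inequality"` (12: Chernodub 2012 doi:10.1103/physrevd.86.107703, Aguado–Asorey
2009 doi:10.1103/physrevd.80.127702, Nussinov 1983 doi:10.1103/physrevlett.51.2081 — VW-theorem
physics and mass inequalities, none on running-mass rates); `lit galaxy search "Vafa-Witten bound"
--star all` and `"paramagnetic inequalities for fermions" --star all` (1 relevant pdf:
Descotes–Stern PRD 62 (2000), finite-volume Dirac spectra — unrelated to rates); `lit frontier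
QuantumFields --since 2020` (30 rows: YM–Higgs scaling limits arXiv:2401.10507, Makeenko–Migdal,
stochastic YM — nothing fermionic); `lit bridges QuantumFields --cross any`; OpenAlex/S2/arXiv
rate-limited this hour (recorded; the card's refuter audit of 12:17Z ran the same sweep and found
nothing joining VW accretivity to block-fermion RG).
Nearest prior art found: VafaWitten1984NPB (pathwise paramagnetic bound at the BARE mass, used for
symmetry non-breaking where the rate's size is irrelevant); Weingarten1983 (γ₅-domination and mas  [refs: 10.1103/physrevd.86.107703, 10.1103/physrevd.80.127702, 10.1103/physrevlett.51.2081, 10.1007/bf01257414, 2401.10507, doi:10.1103/physrevd.86.107703, doi:10.1103/physrevd.80.127702, doi:10.1103/physrevlett.51.2081, doi:10.1007/bf01257414, ChulaevskySuhov2014, Weingarten1983, BalabanOcarrollSchor1989]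

Barriers (technique_class: fermion-positivity-bound, quark-lines, block-rg): - technique_class: fermion-positivity-bound, quark-lines, block-rg
- Literature.Barriers.QuantumFields.VafaWittenEigenvalueBound: EVADED — nothing here gaps the
massless Dirac operator; every decay clause lives at m > 0 (accretivity constant = the running mass)
with rates ∝ (m_f+m_g) vanishing at the chiral point (threshold 0 since the 2026-08-16 re-type), and
the CMP eigenvalue theorem constrains only m = 0. It is also NOT what supplies the new chiral
clause: the printed no-gap consequence needs ≥ 4 massless flavours (flavour chains), so for N_f = 2,
3 `IsChiralAtZero` in LineShieldedChiralContinuum is an imported Goldstone obligation, not a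
Vafa–Witten corollary.
- Literature.Barriers.QuantumFields.HoppingExpansionUniformGap: EVADED as mechanism
(accretivity/numerical range, not |κ|h < 1) and OBEYED as moral: MassRenormalisationDiverges files
precisely this barrier's lesson for ALL configuration-uniform bounds — the rate inside them is a
bare-cutoff number — which is why the crux is the renormalised, measure-level bound.
- Literature.Barriers.QuantumFields.HoppingExpansionLocality: same as the previous line (the ℓ²
operator-norm widening changes nothing: U ≡ 1 saturates).
- Literature.Barriers.QuantumFields.FixedCouplingUltralocality: consistent — the shield's
lattice-unit rate c·(m_f+m_g)·a_k → 0 exactly as a physical mass must along asymptotic scaling; the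
route never uses an a-uniform lattice-unit gap.
- Literature.Barriers.QuantumFields.AokiPhaseDichotomy: APPLIES to cl

History (route lifecycle, newest last):
- 2026-08-16T23:26:48Z · rev 9: restated Assembly (stmt-QuantumFields-8700) — route-repair follow-up: Assembly item restated to the re-typed chain LineShieldedChiralContinuum → GapFromLineShield → QCD (the deciding theorem `closes` proves (planner-rrepair-QuantumFields-RenormalisedVafa-70a051ff-0)
- 2026-08-16T23:33:15Z · rev 10: dropped ThresholdShift — route-repair follow-up: DROP ThresholdShift (8699, proved, shared with 3 routes — unused here since the re-type forbids the m_crit shift; this also removes the (planner-rrepair-QuantumFields-RenormalisedVafa-70a051ff-0)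
- 2026-08-23T05:32:14Z · DORMANT — reconciler: no traction for 5.9 d (last activity statement-checked at 2026-08-17T06:53:34Z); parked, not closed — `ledger route dormant route-QuantumFields-Reno (operator:999:495329)
- 2026-08-28T19:33:16Z · REACTIVATED — reconciler: reactivated — activity statement-closed at 2026-08-28T17:20:55Z after parking at 2026-08-23T05:32:14Z (operator:999:3290848)
- 2026-09-03T11:25:34Z · DORMANT — reconciler: no traction for 5 d (last activity statement-checked at 2026-08-29T10:33:33Z); parked, not closed — `ledger route dormant route-QuantumFields-Renorm (operator:999:1373197)

sub-problem: QCD · status: dormant · opened planner-plancard-QuantumFields-QCD-renormalis-f6a9f0d5-0 2026-08-15T13:27:47Z · rev 11 · ledger route-QuantumFields-RenormalisedVafaWitten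
GENERATED by the gate from the ledger (D-0016/17). Provers cite these decls: `theorem foo : Summit.QuantumFields.QCD.Theses.RenormalisedVafaWitten.<Decl> := …` in Summits/QuantumFields/QCD/Theorems/<Name>.lean.
-/

namespace Summit.QuantumFields.QCD.Theses.RenormalisedVafaWitten

open scoped BigOperators Topology Manifold Classical MeasureTheory ProbabilityTheory Matrix InnerProductSpace ComplexConjugate ContinuousMap
open Filter Set Function TopologicalSpace MeasureTheory

attribute [summit_statement] _root_.QCD

/-! Retired items kept as plain definitions (history; not obligations of this route): landed proofs / closed glue still name them. -/

-- tombstone: stmt-QuantumFields-8699 was DROPPED from this route but is still named by active items / landed proofs — kept as a plain def (no route_item tag), not an obligation of this route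
/-- retired stmt-QuantumFields-8699 (dropped, gen None) — proved by Summit.QuantumFields.QCD.Theorems.thresholdShift_proof. -/
def ThresholdShift : Prop :=
  ∀ (Nf : ℕ) (reg : Literature.MathematicalPhysics.QuantumFieldTheory.QCDRegularisation Nf) (M₀ : ℝ), ∃ reg' : Literature.MathematicalPhysics.QuantumFieldTheory.QCDRegularisation Nf, (reg.HasMassScaling → reg'.HasMassScaling) ∧ ∀ (m : Fin Nf → ℝ) (z shift : Literature.MathematicalPhysics.QuantumFieldTheory.QCDField Nf → ℕ → ℝ), reg'.scheme m z shift = reg.scheme (fun f => m f + M₀) z shift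

/-- item stmt-QuantumFields-17662 · crux · rank 2 · open · by planner
why it might fail: Stacks three open problems on ONE reg: 4D UV existence with dynamical Wilson quarks (m_crit tuned in the flow, renormalon-ambiguous); chiral softness (ii) = Goldstone UPPER law, foreign to paramagnetic LOWER bounds; (iv)'s k,S-uniform C fights ⟨sign⟩⁻¹ for N_f=3 / split N_f=2.
sources: VafaWitten1984NPB, Weingarten1983, BalabanOcarrollSchor1989, Balaban1988Convergent, Dimock2022QED3, MontvayMunster1994
[crux] (card A1 + the shared UV-existence half + the re-typed chiral clause, merged into ONE
existential over the CONSTRUCTED regularisation; replaces RenormalisedQuarkLineBound /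
DynamicalQuarkContinuum / ThresholdShift on the deciding path after the 2026-08-16 re-type of
`QCDOf`) for N_f = 2 and N_f = 3 there is `reg : QCDRegularisation N_f` with (i) `HasMassScaling`;
(ii) `reg.IsChiralAtZero` — for every ε > 0 some positive mass tuple has no uniform lattice gap ε:
the lattice gap closes as m → 0⁺ along the sequence, i.e. m_crit(k) is the chiral point (nothing is
claimed at fixed k); (iii) for every m > 0 some z, shift and `T : OSData (QCDField N_f) 4` with
`IsQCDAlong (reg.scheme m z shift) T`, `T.IsNontrivial glue`, `T.IsNonGaussian glue`,
`T.IsNontrivial (pseudoRe f g)` for all f ≠ g (existence with dynamical quarks, no gap clause); (iv)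
the renormalised quark-line shield at threshold ZERO: for every M̄ there is c > 0 with: for all m ∈
(0, M̄]^{N_f}, all f ≠ g, some C, eventually in k, on every torus 2S+1 ≥ 2L_k+1 and all n ≤ S,
‖⟨P_fg(0) P_gf(n e₀)⟩_{k,S}‖ ≤ C exp(−c(m_f+m_g) a_k n) (`qcdTorusExpect` of the product of the
tree's `pseudoscalarBilinear`s at β_k and bare masses -/
@[route_item "route-QuantumFields-RenormalisedVafaWitten"]
def LineShieldedChiralContinuum : Prop :=
  ∀ Nf : ℕ, (Nf = 2 ∨ Nf = 3) → ∃ reg : Literature.MathematicalPhysics.QuantumFieldTheory.QCDRegularisation Nf, reg.HasMassScaling ∧ reg.IsChiralAtZero ∧ (∀ m : Fin Nf → ℝ, (∀ f, 0 < m f) → ∃ (z shift : Literature.MathematicalPhysics.QuantumFieldTheory.QCDField Nf → ℕ → ℝ) (T : Literature.MathematicalPhysics.QuantumFieldTheory.OSData (Literature.MathematicalPhysics.QuantumFieldTheory.QCDField Nf) 4), Literature.MathematicalPhysics.QuantumFieldTheory.IsQCDAlong (reg.scheme m z shift) T ∧ T.IsNontrivial Literature.MathematicalPhysics.QuantumFieldTheory.QCDField.glue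 ∧ T.IsNonGaussian Literature.MathematicalPhysics.QuantumFieldTheory.QCDField.glue ∧ ∀ f g : Fin Nf, f ≠ g → T.IsNontrivial (Literature.MathematicalPhysics.QuantumFieldTheory.QCDField.pseudoRe f g)) ∧ (∀ Mbar : ℝ, ∃ c : ℝ, 0 < c ∧ ∀ m : Fin Nf → ℝ, (∀ f, 0 < m f ∧ m f ≤ Mbar) → ∀ f g : Fin Nf, f ≠ g → ∃ C : ℝ, ∀ᶠ k in atTop, ∀ S : ℕ, reg.L k ≤ S → ∀ n : ℕ, n ≤ S → ‖Literature.MathematicalPhysics.QuantumFieldTheory.qcdTorusExpect (reg.β k) (2 * S + 1) (fun fl => reg.mcrit k + reg.a k * m fl / reg.Zm k) (fun _ => Literature.MathematicalPhysics.QuantumFieldTheory.pseudoscalarBilinear f g (0 : Literature.Probability.LatticeModels.TorusSite 4 (2 * S + 1)) * Literature.MathematicalPhysics.QuantumFieldTheory.pseudoscalarBilinear g f (fun i : Fin 4 => if i = 0 then ((n : ℕ) : ZMod (2 * S + 1)) else 0))‖ ≤ C * Real.exp (-(c * (m f + m g) * (reg.a k * n))))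

/-- item stmt-QuantumFields-8694 · crux · rank 3 · open · by planner
why it might fail: Neutral sector = k,S-uniform clustering of the unquenched (signed for N_f=3) SU(3) gauge marginal on hairpin/Wilson-loop functionals: the Yang–Mills gap plus a non-local fermionic perturbation; nothing bridges Balaban's small-field UV regime to confinement scales (Δ ∝ e^{−1/(2b₀g₀²)}, PT-invisible).
sources: JaffeWitten2000, Luscher1977, OsterwalderSeiler1978, Seiler1982, Balaban1989LargeFieldII, MagnenRivasseauSeneor1993
[crux] (card A2 + the transfer to the continuum gap) for N_f ∈ {2,3}, every `reg` with
`HasMassScaling` and admissibility data, every M₀ ≥ 0 for which the line bound of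
RenormalisedQuarkLineBound holds above M₀: for all m with every m_f > M₀ and every z, shift, T with
`IsQCDAlong (reg.scheme m z shift) T` there is Δ > 0 with `T.HasMassGap Δ ∧ (reg.scheme m z
shift).HasLatticeMassGap Δ`. With the cross-contracted diagrams shielded, what remains is clustering
of the unquenched (signed) gauge marginal on the line-disconnected functionals Wick(A), Wick(B) —
the perturbed pure-gauge core — plus the transfer-matrix bookkeeping from operator-norm-uniform
lattice decay to `T.HasMassGap`. [deps: RenormalisedQuarkLineBound] [difficulty: open-problem] -/
@[route_item "route-QuantumFields-RenormalisedVafaWitten"]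
def GapFromLineShield : Prop :=
  ∀ (Nf : ℕ) (reg : Literature.MathematicalPhysics.QuantumFieldTheory.QCDRegularisation Nf) (M₀ : ℝ), (Nf = 2 ∨ Nf = 3) → reg.HasMassScaling → (∀ m : Fin Nf → ℝ, (∀ f, 0 < m f) → ∃ (z shift : Literature.MathematicalPhysics.QuantumFieldTheory.QCDField Nf → ℕ → ℝ) (T : Literature.MathematicalPhysics.QuantumFieldTheory.OSData (Literature.MathematicalPhysics.QuantumFieldTheory.QCDField Nf) 4), Literature.MathematicalPhysics.QuantumFieldTheory.IsQCDAlong (reg.scheme m z shift) T ∧ ∀ f g : Fin Nf, f ≠ g → T.IsNontrivial (Literature.MathematicalPhysics.QuantumFieldTheory.QCDField.pseudoRe f g)) → 0 ≤ M₀ → (∀ Mbar : ℝ, ∃ c : ℝ, 0 < c ∧ ∀ m : Fin Nf → ℝ, (∀ f, M₀ < m f ∧ m f ≤ Mbar) → ∀ f g : Fin Nf, f ≠ g → ∃ C : ℝ, ∀ᶠ k in atTop, ∀ S : ℕ, reg.L k ≤ S → ∀ n : ℕ, n ≤ S → ‖Literature.MathematicalPhysics.QuantumFieldTheory.qcdTorusExpect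 (reg.β k) (2 * S + 1) (fun fl => reg.mcrit k + reg.a k * m fl / reg.Zm k) (fun _ => Literature.MathematicalPhysics.QuantumFieldTheory.pseudoscalarBilinear f g (0 : Literature.Probability.LatticeModels.TorusSite 4 (2 * S + 1)) * Literature.MathematicalPhysics.QuantumFieldTheory.pseudoscalarBilinear g f (fun i : Fin 4 => if i = 0 then ((n : ℕ) : ZMod (2 * S + 1)) else 0))‖ ≤ C * Real.exp (-(c * ((m f - M₀) + (m g - M₀)) * (reg.a k * n)))) → ∀ m : Fin Nf → ℝ, (∀ f, M₀ < m f) → ∀ (z shift : Literature.MathematicalPhysics.QuantumFieldTheory.QCDField Nf → ℕ → ℝ) (T : Literature.MathematicalPhysics.QuantumFieldTheory.OSData (Literature.MathematicalPhysics.QuantumFieldTheory.QCDField Nf) 4), Literature.MathematicalPhysics.QuantumFieldTheory.IsQCDAlong (reg.scheme m z shift) T → ∃ Δ : ℝ, 0 < Δ ∧ T.HasMassGap Δ ∧ (reg.scheme m z shift).HasLatticeMassGap Δ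

/-- item stmt-QuantumFields-8693 · support · rank 2 · open · by planner
why it might fail: Signed weight: for N_f=3 and mass-split N_f=2 a pathwise shield pays ⟨sign⟩⁻¹_{k,S} (odd-Q/real-mode fields) — no k,S-uniform C; accretivity is not RG-covariant (blocked Wilson kernel need not be antiHermitian + ≥ running mass); (−1)^F-twisted torus needs vacuum dominance; Aoki fingers ∀ m>M₀.
sources: VafaWitten1984NPB, Weingarten1983, BalabanOcarrollSchor1989, Dimock2022QED3, SharpeSingleton1998, MontvayMunster1994
[crux] (card A1, threshold form) for N_f ∈ {2,3} and every `reg : QCDRegularisation N_f` with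
`HasMassScaling` carrying admissibility data (∀ m > 0 ∃ z shift T, `IsQCDAlong (reg.scheme m z
shift) T` ∧ ∀ f ≠ g, `T.IsNontrivial (pseudoRe f g)`), there is M₀ ≥ 0 such that for every M̄ there
is c > 0 with: for all m ∈ (M₀, M̄]^{N_f}, all f ≠ g, some C, eventually in k, on every torus 2S+1 ≥
2L_k+1 and all n ≤ S, ‖⟨P_fg(0) P_gf(n e₀)⟩_{k,S}‖ ≤ C exp(−c((m_f−M₀)+(m_g−M₀)) a_k n)
(`qcdTorusExpect` of the product of the tree's `pseudoscalarBilinear`s at the scheme's β_k and bare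
masses m_crit(k) + a_k m/Z_m(k); ⟨P_fg⟩ = 0 by flavour symmetry, so this IS the connected function).
Most informative item: if it is unreachable the quantum-number cut is illusory. [difficulty:
open-problem] -/
@[route_item "route-QuantumFields-RenormalisedVafaWitten"]
def RenormalisedQuarkLineBound : Prop :=
  ∀ (Nf : ℕ) (reg : Literature.MathematicalPhysics.QuantumFieldTheory.QCDRegularisation Nf), (Nf = 2 ∨ Nf = 3) → reg.HasMassScaling → (∀ m : Fin Nf → ℝ, (∀ f, 0 < m f) → ∃ (z shift : Literature.MathematicalPhysics.QuantumFieldTheory.QCDField Nf → ℕ → ℝ) (T : Literature.MathematicalPhysics.QuantumFieldTheory.OSData (Literature.MathematicalPhysics.QuantumFieldTheory.QCDField Nf) 4), Literature.MathematicalPhysics.QuantumFieldTheory.IsQCDAlong (reg.scheme m z shift) T ∧ ∀ f g : Fin Nf, f ≠ g → T.IsNontrivial (Literature.MathematicalPhysics.QuantumFieldTheory.QCDField.pseudoRe f g)) → ∃ M₀ : ℝ, 0 ≤ M₀ ∧ ∀ Mbar : ℝ, ∃ c : ℝ, 0 < c ∧ ∀ m : Fin Nf → ℝ, (∀ f, M₀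 < m f ∧ m f ≤ Mbar) → ∀ f g : Fin Nf, f ≠ g → ∃ C : ℝ, ∀ᶠ k in atTop, ∀ S : ℕ, reg.L k ≤ S → ∀ n : ℕ, n ≤ S → ‖Literature.MathematicalPhysics.QuantumFieldTheory.qcdTorusExpect (reg.β k) (2 * S + 1) (fun fl => reg.mcrit k + reg.a k * m fl / reg.Zm k) (fun _ => Literature.MathematicalPhysics.QuantumFieldTheory.pseudoscalarBilinear f g (0 : Literature.Probability.LatticeModels.TorusSite 4 (2 * S + 1)) * Literature.MathematicalPhysics.QuantumFieldTheory.pseudoscalarBilinear g f (fun i : Fin 4 => if i = 0 then ((n : ℕ) : ZMod (2 * S + 1)) else 0))‖ ≤ C * Real.exp (-(c * ((m f - M₀) + (m g - M₀)) * (reg.a k * n)))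

/-- item stmt-QuantumFields-8695 · support · rank 4 · open · by planner
why it might fail: No 4D construction with dynamical fermions exists (BOS: external field; Dimock: QED₃; Balaban/MRS: pure YM, finite volume); m_crit(k) must be tuned non-perturbatively in the flow (linear divergence, renormalon-ambiguous); IsNonGaussian glue and all-n Schwinger convergence need observable control.
sources: JaffeWitten2000, Balaban1988Convergent, BalabanOcarrollSchor1989, Dimock2022QED3, GawedzkiKupiainenMasslessLattice1985, MagnenRivasseauSeneor1993
[crux] (the UV existence half shared by every QCD line, stated gap-free) for N_f = 2 and N_f = 3
there is `reg : QCDRegularisation N_f` with `HasMassScaling` such that for every m > 0 some z, shift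
and `T : OSData (QCDField N_f) 4` satisfy `IsQCDAlong (reg.scheme m z shift) T`, `T.IsNontrivial
glue`, `T.IsNonGaussian glue` and `T.IsNontrivial (pseudoRe f g)` for all f ≠ g. It supplies the
admissibility data of the two cruxes above and nothing about gaps. [difficulty: open-problem] -/
@[route_item "route-QuantumFields-RenormalisedVafaWitten"]
def DynamicalQuarkContinuum : Prop :=
  ∀ Nf : ℕ, (Nf = 2 ∨ Nf = 3) → ∃ reg : Literature.MathematicalPhysics.QuantumFieldTheory.QCDRegularisation Nf, reg.HasMassScaling ∧ ∀ m : Fin Nf → ℝ, (∀ f, 0 < m f) → ∃ (z shift : Literature.MathematicalPhysics.QuantumFieldTheory.QCDField Nf → ℕ → ℝ) (T : Literature.MathematicalPhysics.QuantumFieldTheory.OSData (Literature.MathematicalPhysics.QuantumFieldTheory.QCDField Nf) 4), Literature.MathematicalPhysics.QuantumFieldTheory.IsQCDAlong (reg.scheme m z shift) T ∧ T.IsNontrivial Literature.MathematicalPhysics.QuantumFieldTheory.QCDField.glue ∧ T.IsNonGaussian Literature.MathematicalPhysics.QuantumFieldTheory.QCDField.glue ∧ ∀ f g : Fin Nf,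 f ≠ g → T.IsNontrivial (Literature.MathematicalPhysics.QuantumFieldTheory.QCDField.pseudoRe f g)

/-- item stmt-QuantumFields-8696 · support · rank 9 · closed · proved by Summit.QuantumFields.QCD.Theorems.renormalisedVafaWitten_accretiveCombesThomas_proof (prover) · by planner
sources: ChulaevskySuhov2014, VafaWitten1984NPB, tree:Literature.Barriers.QuantumFields.HoppingExpansionUniformGap_holds
[support] (card F1/A4, abstract form; provable now) on a finite index set with a symmetric integer
quasi-metric `dist`, a matrix D of range ≤ 1 that is m-accretive (m Σ‖v_i‖² ≤ Re⟨v, Dv⟩, m > 0) with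
off-diagonal row and column ℓ¹-sums ≤ h is invertible and, for every θ ≥ 0 with h(e^θ − 1) ≤ m/2,
obeys ‖D⁻¹ i j‖ ≤ (2/m) e^{−θ·dist i j}. Proof: conjugate by e^{θ dist(·,j)}, Schur-bound the
perturbation by h(e^θ−1) ≤ m/2, keep accretivity m/2, invert. Twin of the tree's
`HoppingExpansionUniformGap_holds` with accretivity replacing |κ|h < 1; it is the configuration-wise
shield whose rate F2 shows to be bare. [difficulty: provable-now] -/
@[route_item "route-QuantumFields-RenormalisedVafaWitten"]
def AccretiveCombesThomas : Prop :=
  ∀ (ι : Type) [Fintype ι] [DecidableEq ι] (dist : ι → ι → ℕ) (D : Matrix ι ι ℂ) (m h θ : ℝ), (∀ i, dist i i = 0) → (∀ i j, dist i j = dist j i) → (∀ i j k, dist i k ≤ dist i j + dist j k) → (∀ i j, D i j ≠ 0 → dist i j ≤ 1) → 0 < m → (∀ v : ι → ℂ, m * ∑ i, ‖v i‖ ^ 2 ≤ (∑ i, star (v i) * D.mulVec v i).re) → (∀ i, ∑ j ∈ Finset.univ.erase i, ‖D i j‖ ≤ h) → (∀ j, ∑ i ∈ Finset.univ.erase j,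 ‖D i j‖ ≤ h) → 0 ≤ θ → h * (Real.exp θ - 1) ≤ m / 2 → IsUnit D.det ∧ ∀ i j, ‖D⁻¹ i j‖ ≤ 2 / m * Real.exp (-(θ * dist i j))

-- `AccretiveCombesThomas` holds: proved by `Summit.QuantumFields.QCD.Theorems.renormalisedVafaWitten_accretiveCombesThomas_proof` (its module imports this route file, so no `_holds` link can be stated here).

/-- item stmt-QuantumFields-8697 · support · rank 9 · closed · proved by Summit.QuantumFields.QCD.Theorems.renormalisedVafaWitten_wilsonDiracAccretive_proof (prover) · by planner
sources: MontvayMunster1994, VafaWitten1984NPB, Wilson1975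
[support] (card F1 for Wilson; provable now) for a unitary representation ρ, any gauge field U on
any torus, r ≥ 0 and any real m, the tree's `wilsonDirac ρ U m r` satisfies m Σ‖v_i‖² ≤ Re⟨v, D_W
v⟩: its Hermitian part is (m+4r) − (r/2)Σ_μ(𝒯_μ+𝒯_μ†) ≥ m with 𝒯_μ the unitary covariant shifts, the
γ_μ part being anti-Hermitian. With AccretiveCombesThomas this is the pathwise Vafa–Witten shield at
each k where the bare mass is positive — and it is EMPTY along the honest Wilson trajectory once
m_crit(k) < 0, which is why the crux is renormalised. [difficulty: provable-now] -/
@[route_item "route-QuantumFields-RenormalisedVafaWitten"]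
def WilsonDiracAccretive : Prop :=
  ∀ (L N : ℕ) [NeZero L] (G : Type) [Group G] (ρ : G →* Matrix (Fin N) (Fin N) ℂ), (∀ g, ρ g ∈ Matrix.unitaryGroup (Fin N) ℂ) → ∀ (U : Literature.MathematicalPhysics.QuantumFieldTheory.GaugeConfig 4 L G) (m r : ℝ), 0 ≤ r → ∀ v : Literature.Probability.LatticeModels.TorusSite 4 L × Fin N × Fin 4 → ℂ, m * ∑ i, ‖v i‖ ^ 2 ≤ (∑ i, star (v i) * (Literature.MathematicalPhysics.QuantumLattice.wilsonDirac ρ U m r).mulVec v i).re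

-- `WilsonDiracAccretive` holds: proved by `Summit.QuantumFields.QCD.Theorems.renormalisedVafaWitten_wilsonDiracAccretive_proof` (its module imports this route file, so no `_holds` link can be stated here).

/-- item stmt-QuantumFields-8698 · support · rank 9 · closed · proved by Summit.QuantumFields.QCD.Theorems.renormalisedVafaWitten_massRenormalisationDiverges_proof (prover) · by planner
sources: MontvayMunster1994, tree:Literature.MathematicalPhysics.QuantumFieldTheory.massExponent_three
[support] (the formal half of the card's negative lemma F2/A3; provable now) for N_f ≤ 16 and every
`reg` with `HasMassScaling`, Z_m(k) → ∞; hence the bare mass realising a fixed renormalised mass is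
m/Z_m(k) → 0 in PHYSICAL units, and no configuration-uniform rate (AccretiveCombesThomas ∘
WilsonDiracAccretive, saturated by U ≡ 1 at the free pole mass log(1 + a_k m/Z_m(k))) can be
k-uniform in physical units — the design rule refuters may cite against pathwise-rate claims.
[difficulty: provable-now] -/
@[route_item "route-QuantumFields-RenormalisedVafaWitten"]
def MassRenormalisationDiverges : Prop :=
  ∀ (Nf : ℕ), Nf ≤ 16 → ∀ reg : Literature.MathematicalPhysics.QuantumFieldTheory.QCDRegularisation Nf, reg.HasMassScaling → Tendsto reg.Zm atTop atTop

-- `MassRenormalisationDiverges` holds: proved by `Summit.QuantumFields.QCD.Theorems.renormalisedVafaWitten_massRenormalisationDiverges_proof` (its module imports this route file, so no `_holds` link can be stated here).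

-- earlier Assembly (stmt-QuantumFields-8700, replaced 2026-08-16T23:26:48Z -> stmt-QuantumFields-17677): retired by None — RenormalisedQuarkLineBound → GapFromLineShield → DynamicalQuarkContinuum → ThresholdShift → QCD
/-- item stmt-QuantumFields-17677 · assembly · rank 1 · closed · proved by Summit.QuantumFields.QCD.Theorems.renormalisedVafaWitten_assembly_proof (prover) · by planner
sources: JaffeWitten2000, MontvayMunster1994
[assembly] LineShieldedChiralContinuum → GapFromLineShield → QCD (re-typed 2026-08-16: the exhibited
regularisation is used unshifted; `closes` is the proof). -/
@[route_item "route-QuantumFields-RenormalisedVafaWitten"]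
def Assembly : Prop :=
  LineShieldedChiralContinuum → GapFromLineShield → QCD

-- `Assembly` holds: proved by `Summit.QuantumFields.QCD.Theorems.renormalisedVafaWitten_assembly_proof` (its module imports this route file, so no `_holds` link can be stated here).

-- records of items no longer active in this route (dropped / restated):
-- earlier ThresholdShift (stmt-QuantumFields-8699, dropped 2026-08-16T23:33:15Z): proved by Summit.QuantumFields.QCD.Theorems.thresholdShift_proof — ∀ (Nf : ℕ) (reg : Literature.MathematicalPhysics.QuantumFieldTheory.QCDRegularisation Nf) (M₀ : ℝ), ∃ reg' : Literature.MathematicalPhysics.QuantumFieldTheory.QCDRegularisation Nf, (reg.HasMassScaling → reg'.HasMassScaling) ∧ ∀ (m : Fin Nf → ℝ) (z shift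

/-! D-0027 §2.1 — DECIDING THEOREM (planner-authored via `route open/edit --closes-file`; by planner-rrepair-QuantumFields-RenormalisedVafa-70a051ff-0 2026-08-16T23:26:17Z):
its hypotheses are this route's items and its conclusion the sub-problem Statement (glue_lint), and it elaborates with this file. -/

/-- D-0027 §2.1 deciding theorem (re-elaborated after the 2026-08-16 re-type of `QCDOf`, which gained
the conjunct `reg.IsChiralAtZero`): the route's two cruxes close the sub-problem statement `QCD`.
`LineShieldedChiralContinuum` (A) supplies, for `N_f ∈ {2,3}`, ONE regularisation with `HasMassScaling`,
`IsChiralAtZero` (the new conjunct, carried verbatim), the dynamical-quark existence data at every positive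
mass tuple and the renormalised quark-line shield at threshold `0`; `GapFromLineShield` (G), used at
`M₀ = 0`, turns the shield into one `Δ > 0` with `T.HasMassGap Δ ∧ HasLatticeMassGap Δ` for every `m > 0`
and the data's own `(z, shift, T)`. Pure logic; the exhibited `reg` is used UNSHIFTED (no `ThresholdShift`). -/
@[closes "route-QuantumFields-RenormalisedVafaWitten"] theorem closes (hA : LineShieldedChiralContinuum) (hG : GapFromLineShield) : QCD := by
  have key : ∀ Nf : ℕ, (Nf = 2 ∨ Nf = 3) → QCDOf Nf := by
    intro Nf hNf
    obtain ⟨reg, hms, hchi, hdata, hLB⟩ := hA Nf hNf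
    have hadm : ∀ m : Fin Nf → ℝ, (∀ f, 0 < m f) →
        ∃ (z shift : Literature.MathematicalPhysics.QuantumFieldTheory.QCDField Nf → ℕ → ℝ)
          (T : Literature.MathematicalPhysics.QuantumFieldTheory.OSData
            (Literature.MathematicalPhysics.QuantumFieldTheory.QCDField Nf) 4),
          Literature.MathematicalPhysics.QuantumFieldTheory.IsQCDAlong (reg.scheme m z shift) T ∧
            ∀ f g : Fin Nf, f ≠ g →
              T.IsNontrivial (Literature.MathematicalPhysics.QuantumFieldTheory.QCDField.pseudoRe f g) := by
      intro m hm
      obtain ⟨z, shift, T, h1, -, -, h4⟩ := hdata m hm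
      exact ⟨z, shift, T, h1, h4⟩
    have hgap := hG Nf reg 0 hNf hms hadm le_rfl (by simpa only [sub_zero] using hLB)
    refine ⟨reg, hms, hchi, fun m hm => ?_⟩
    obtain ⟨z, shift, T, hqcd, hnt, hng, hnd⟩ := hdata m hm
    obtain ⟨Δ, hΔ, hgapT, hgapL⟩ := hgap m hm z shift T hqcd
    exact ⟨z, shift, T, hqcd, hnt, hng, hnd, Δ, hΔ, hgapT, hgapL⟩
  exact ⟨key 2 (Or.inl rfl), key 3 (Or.inr rfl)⟩

end Summit.QuantumFields.QCD.Theses.RenormalisedVafaWitten
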